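import Mathlib
import Literature.MathematicalPhysics.QuantumFieldTheory.Balaban1983to89.B9Eq331LatticeCov

/-!
# [B8] (1.27)/(1.38)/(1.146): the Landau gauge conditions relative to U₀ are COVARIANT under gauge transformations of the
# background, on the (3.25)-lattice carriers — from [4] (3.31)–(3.33) (`B9Eq331LatticeCov`)

statement-level skeleton of published theorems with citation tags; proofs where landed; nothing here is a claim
about the Yang–Mills mass gap

Seat p40 gen 9, Phase 2 (free target; owner r05 rows B8.Eq1.27 / B8.Eq1.36 ((1.38)) / B8.Eq1.146, xref r06 B9.Eq3.28).
Sources: [Balaban1985RegularSpaces] T. Bałaban, *Spaces of regular gauge field configurations on a lattice and gauge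
fixing conditions*, CMP 99 (1985) 75–102: (1.27) p. 80 «An operator R(U₀) is defined as an orthogonal projection in this
real Hilbert space, onto the subspace Δ^η_{U₀}N(Q′(U₀)).  The Landau gauge condition … R(U₀)D^{η*}_{U₀}(1/i) log U′ = 0.
(1.27)», (1.38) p. 82, (1.146) p. 101 «R(U₀)D^{η*}_{U₀}A = f, f is a function from the space R(U₀)»;
[Balaban1985BackgroundPropagators] (3.31)–(3.33) pp. 395–396 «Δ^η_{U^u} = R(u)Δ^η_UR(u⁻¹) (3.31) … (Q′_j(U^u)R(u)λ)(y) =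
R(u(y))(Q′_j(U)λ)(y) (3.32) … R(U^u) = R(u)R(U)R(u⁻¹) (3.33)».

WHY THIS FILE.  r05's `B8Eq127LandauGauge` types the three Landau conditions on the carriers in VARIATIONAL form
(`IsLandauBG Δ q X` ⟺ X ⊥ Δ^η_{U₀}N(Q′(U₀)); lattice `LandauBGL`, `Landau138L`, `Landau146L`) and identifies them
with «R X = 0» / «R X = f» for the printed R of [4] (3.25).  [4] (3.33) «R(U^u) = R(u)R(U)R(u⁻¹)» makes these conditions
covariant under a gauge transformation u of the BACKGROUND: X satisfies the Landau condition relative to U₀ iff R(u)X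
satisfies it relative to U₀^u (with D^{η*}_{U₀^u}(R(u)A) = R(u)D^{η*}_{U₀}A for the bond-field forms).  This file proves
exactly that, abstractly from the intertwining relations (3.31)/(3.32) and concretely on the carriers from
`B9Eq331LatticeCov` — for every background, every u : X → O(𝔤), every block system whose contours end at their sites
(no regularity, no (3.25)-data needed: the variational form only sees Δ and Q′).

CONTENT.
§1 ABSTRACT (the setting of `B9Eq333Cov`: Δ′T = TΔ, Q′′T = SQ′, T scalar-product preserving and onto, S injective):
   **`isLandauBG_intertwine_iff`** (IsLandauBG Δ′ Q′′ (TX) ⟺ IsLandauBG Δ Q′ X), `mem_lapKer_intertwine_iff` (the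
   space R(U₀) = Δ^η_{U₀}N(Q′(U₀)) is mapped onto R(U₀^u)'s), **`isLandauSrc_intertwine_iff`** ((1.146)'s form).
§2 ON THE CARRIERS: `adjoint_DL_conjT` (D^{η*}_{U^u}R(u(b₋)) = R(u)D^{η*}_U — orthogonality of R(u)),
   **`landauBGL_conjT_iff`** ((1.27): «R(U₀^u)(R(u)X) = 0 ⟺ R(U₀)X = 0»), **`landau138L_conjT_iff`** ((1.38)/(1.42) for
   bond fields A ↦ R(u(b₋))A), **`landau146L_conjT_iff`** ((1.146) with source f ↦ R(u)f).

HONEST SCOPE.  Gauge transformations of the BACKGROUND U₀ with the test function transformed along (X ↦ R(u)X,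
A ↦ R(u(b₋))A); the transformation (1.17) of the RELATIVE variable U′ at fixed U₀ is a different statement (row
B8.Eq1.16, proved-existing elsewhere) and is not treated; fibre = any finite-dimensional real inner-product space acted
on by linear isometries; no bound, no row head changes.
-/

namespace Literature.MathematicalPhysics.QuantumFieldTheory.Balaban1983to89.B8Eq127LandauGaugeCov

open Literature.MathematicalPhysics.QuantumFieldTheory.Balaban1983to89.B9Eq325Proj
  Literature.MathematicalPhysics.QuantumFieldTheory.Balaban1983to89.B9Thm311Lattice
  Literature.MathematicalPhysics.QuantumFieldTheory.Balaban1983to89.B9Eq333Cov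
  Literature.MathematicalPhysics.QuantumFieldTheory.Balaban1983to89.B8Eq127LandauGauge
  Literature.MathematicalPhysics.QuantumFieldTheory.Balaban1983to89.B9Eq331LatticeCov
open scoped InnerProductSpace

/-! ## §1  Abstract: the variational Landau conditions under intertwiners -/

section Abstract

variable {E F : Type*} [NormedAddCommGroup E] [InnerProductSpace ℝ E] [NormedAddCommGroup F]
  [InnerProductSpace ℝ F]
variable {Δ Δ' : E →ₗ[ℝ] E} {q q' : E →ₗ[ℝ] F} {T : E →ₗ[ℝ] E} {S : F →ₗ[ℝ] F}

/-- **Covariance of «R(U₀)X = 0»** (variational form): if Δ^η_{U^u}T = TΔ^η_U ((3.31)), Q′(U^u)T = SQ′(U) ((3.32)) with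
S injective and T scalar-product preserving and onto, then TX ⊥ Δ_{U^u}N(Q′(U^u)) ⟺ X ⊥ Δ_UN(Q′(U)).
[cite: Balaban1985BackgroundPropagators, (3.31)–(3.33) pp. 395–396; Balaban1985RegularSpaces, (1.27) p. 80] -/
theorem isLandauBG_intertwine_iff (h31 : ∀ x, Δ' (T x) = T (Δ x)) (h32a : ∀ x, q' (T x) = S (q x))
    (hSi : Function.Injective S) (hT : ∀ x y : E, ⟪T x, T y⟫_ℝ = ⟪x, y⟫_ℝ) (hTs : Function.Surjective T) (X : E) :
    IsLandauBG Δ' q' (T X) ↔ IsLandauBG Δ q X := by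
  constructor
  · intro h l hl
    have h1 : q' (T l) = 0 := by rw [h32a, hl, map_zero]
    have h2 := h (T l) h1
    rwa [h31, hT] at h2
  · intro h l' hl'
    obtain ⟨l, rfl⟩ := hTs l'
    have hl : q l = 0 := (ker_iff h32a hSi l).1 hl'
    rw [h31, hT]
    exact h l hl

/-- The space R(U₀) = Δ_UN(Q′(U)) is mapped by T onto Δ_{U^u}N(Q′(U^u)): T f ∈ Δ′N(Q′′) ⟺ f ∈ ΔN(Q′).
[cite: Balaban1985BackgroundPropagators, (3.33) p. 396; Balaban1985RegularSpaces, (1.27) p. 80] -/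
theorem mem_lapKer_intertwine_iff (h31 : ∀ x, Δ' (T x) = T (Δ x)) (h32a : ∀ x, q' (T x) = S (q x))
    (hSi : Function.Injective S) (hT : ∀ x y : E, ⟪T x, T y⟫_ℝ = ⟪x, y⟫_ℝ) (hTs : Function.Surjective T) (f : E) :
    T f ∈ lapKer Δ' q' ↔ f ∈ lapKer Δ q := by
  refine ⟨fun h => ?_, mem_lapKer_of_intertwine h31 h32a hSi⟩
  obtain ⟨ω, hω, he⟩ := exists_of_mem_lapKer h31 h32a hSi hTs h
  have hinj : Function.Injective T := fun a b hab => by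
    have h0 : ⟪T (a - b), T (a - b)⟫_ℝ = 0 := by rw [map_sub, hab, sub_self, inner_zero_left]
    rw [hT] at h0
    exact sub_eq_zero.1 (inner_self_eq_zero.1 h0)
  rwa [hinj he]

/-- **Covariance of «R(U₀)X = f, f ∈ R(U₀)»** ((1.146)'s variational form).
[cite: Balaban1985RegularSpaces, (1.146) p. 101; Balaban1985BackgroundPropagators, (3.33) p. 396] -/
theorem isLandauSrc_intertwine_iff (h31 : ∀ x, Δ' (T x) = T (Δ x)) (h32a : ∀ x, q' (T x) = S (q x))
    (hSi : Function.Injective S) (hT : ∀ x y : E, ⟪T x, T y⟫_ℝ = ⟪x, y⟫_ℝ) (hTs : Function.Surjective T)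
    (f X : E) : IsLandauSrc Δ' q' (T f) (T X) ↔ IsLandauSrc Δ q f X := by
  unfold IsLandauSrc
  rw [mem_lapKer_intertwine_iff h31 h32a hSi hT hTs, ← map_sub, isLandauBG_intertwine_iff h31 h32a hSi hT hTs]

end Abstract

/-! ## §2  On the carriers: (1.27), (1.38), (1.146) relative to U₀^u versus U₀ -/

section Lattice

variable {X : Type*} {Y : Type*} {V : Type*} [NormedAddCommGroup V] [InnerProductSpace ℝ V]
variable [Fintype X] [Fintype Y] [FiniteDimensional ℝ V]
variable (u : X → V ≃ₗᵢ[ℝ] V) (τ : X → X → V →ₗ[ℝ] V) (bonds : Finset (X × X)) (cb : X × X → ℝ)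
  {w : Y → X → ℝ} {B : Y → Finset X} {Γ : Y → X → List X} {y : Y → X}

/-- D^{η*} is covariant: D^{η*}_{U^u}R(u(b₋)) = R(u)D^{η*}_U on the carriers (from D_{U^u}R(u) = R(u(b₋))D_U and the
orthogonality of R(u), R(u(b₋)) — `B9Eq333Cov.adj_intertwine`).
[cite: Balaban1985BackgroundPropagators, (3.23) p. 394, (3.31) p. 395] -/
theorem adjoint_DL_conjT (Af : PiLp 2 (fun _ : ↥bonds => V)) :
    LinearMap.adjoint (DL (conjT u τ) bonds cb) (gaugeB u bonds Af)
      = gaugeE u (LinearMap.adjoint (DL τ bonds cb) Af) :=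
  adj_intertwine (T := (gaugeE u).toLinearEquiv.toLinearMap) (S := (gaugeB u bonds).toLinearEquiv.toLinearMap)
    (fun f F => (LinearMap.adjoint_inner_right (DL τ bonds cb) f F).symm)
    (fun f F => (LinearMap.adjoint_inner_right (DL (conjT u τ) bonds cb) f F).symm)
    (fun f g => (gaugeE u).inner_map_map f g) (fun F G => (gaugeB u bonds).inner_map_map F G)
    (gaugeE u).surjective (fun f => DL_conjT u τ bonds cb f) Af

/-- **(1.27) is covariant in the background**: for every u : X → O(𝔤) and every site function X,
«R(U₀^u)(R(u)X) = 0» ⟺ «R(U₀)X = 0» (variational forms `LandauBGL`), for every block system whose contours end at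
their sites. [cite: Balaban1985RegularSpaces, (1.27) p. 80; Balaban1985BackgroundPropagators, (3.33) p. 396] -/
theorem landauBGL_conjT_iff (hlast : ∀ c, ∀ x ∈ B c, (y c :: Γ c x).getLast (List.cons_ne_nil _ _) = x)
    (Xf : PiLp 2 (fun _ : X => V)) :
    LandauBGL (conjT u τ) bonds cb w B Γ y (gaugeE u Xf) ↔ LandauBGL τ bonds cb w B Γ y Xf :=
  isLandauBG_intertwine_iff (T := (gaugeE u).toLinearEquiv.toLinearMap) (S := (gaugeF u y).toLinearEquiv.toLinearMap)
    (fun f => lapL_conjT u τ bonds cb f) (fun f => qL_conjT u τ hlast f) (gaugeF u y).injective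
    (fun f g => (gaugeE u).inner_map_map f g) (gaugeE u).surjective Xf

/-- **(1.38)/(1.42) is covariant in the background**: for a bond field A, «R(U₀^u)D^{η*}_{U₀^u}(R(u(b₋))A) = 0» ⟺
«R(U₀)D^{η*}_{U₀}A = 0». [cite: Balaban1985RegularSpaces, (1.38) p. 82; Balaban1985BackgroundPropagators, (3.31) p. 395,
(3.33) p. 396] -/
theorem landau138L_conjT_iff (hlast : ∀ c, ∀ x ∈ B c, (y c :: Γ c x).getLast (List.cons_ne_nil _ _) = x)
    (Af : PiLp 2 (fun _ : ↥bonds => V)) :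
    Landau138L (conjT u τ) bonds cb w B Γ y (gaugeB u bonds Af) ↔ Landau138L τ bonds cb w B Γ y Af := by
  unfold Landau138L
  rw [adjoint_DL_conjT]
  exact landauBGL_conjT_iff u τ bonds cb hlast _

/-- **(1.146) is covariant in the background**: «R(U₀^u)D^{η*}_{U₀^u}(R(u(b₋))A) = R(u)f, R(u)f ∈ R(U₀^u)» ⟺
«R(U₀)D^{η*}_{U₀}A = f, f ∈ R(U₀)» (Theorem 8's source form). [cite: Balaban1985RegularSpaces, (1.146) p. 101;
Balaban1985BackgroundPropagators, (3.33) p. 396] -/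
theorem landau146L_conjT_iff (hlast : ∀ c, ∀ x ∈ B c, (y c :: Γ c x).getLast (List.cons_ne_nil _ _) = x)
    (f : PiLp 2 (fun _ : X => V)) (Af : PiLp 2 (fun _ : ↥bonds => V)) :
    Landau146L (conjT u τ) bonds cb w B Γ y (gaugeE u f) (gaugeB u bonds Af) ↔ Landau146L τ bonds cb w B Γ y f Af := by
  unfold Landau146L
  rw [adjoint_DL_conjT]
  exact isLandauSrc_intertwine_iff (T := (gaugeE u).toLinearEquiv.toLinearMap)
    (S := (gaugeF u y).toLinearEquiv.toLinearMap) (fun g => lapL_conjT u τ bonds cb g)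
    (fun g => qL_conjT u τ hlast g) (gaugeF u y).injective (fun g g' => (gaugeE u).inner_map_map g g')
    (gaugeE u).surjective f _

/-- The space «R(U₀)» = Δ^η_{U₀}N(Q′(U₀)) of admissible sources is mapped by R(u) onto that of U₀^u.
[cite: Balaban1985RegularSpaces, (1.146) p. 101; Balaban1985BackgroundPropagators, (3.33) p. 396] -/
theorem mem_lapKer_conjT_iff (hlast : ∀ c, ∀ x ∈ B c, (y c :: Γ c x).getLast (List.cons_ne_nil _ _) = x)
    (f : PiLp 2 (fun _ : X => V)) :
    gaugeE u f ∈ lapKer (lapL (conjT u τ) bonds cb) (qL (conjT u τ) w B Γ y)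
      ↔ f ∈ lapKer (lapL τ bonds cb) (qL τ w B Γ y) :=
  mem_lapKer_intertwine_iff (T := (gaugeE u).toLinearEquiv.toLinearMap)
    (S := (gaugeF u y).toLinearEquiv.toLinearMap) (fun g => lapL_conjT u τ bonds cb g)
    (fun g => qL_conjT u τ hlast g) (gaugeF u y).injective (fun g g' => (gaugeE u).inner_map_map g g')
    (gaugeE u).surjective f

end Lattice

end Literature.MathematicalPhysics.QuantumFieldTheory.Balaban1983to89.B8Eq127LandauGaugeCov
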